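import Summits.QuantumFields.QCD.Theorems.HeatSlicedQuarksWilsonLichnerowiczShapes

/-!
# Item stmt-QuantumFields-8874 · `WilsonLichnerowicz` (support of route HeatSlicedQuarks) — proved

`wilsonLichnerowicz_proof : Summit.QuantumFields.QCD.Theses.HeatSlicedQuarks.WilsonLichnerowicz`
with the absolute constant `C = 90 √2`: for every torus side `L`, every `SU(3)` lattice gauge
field `U`, every bare mass `m ∈ [-1/2, 1]` and every quark field `v`,

  `½ Σ_{x,μ} |U(x,μ) v(x+μ̂) - v(x)|² ≤ ‖D_W(U,m,1) v‖² + C Σ_x V(U,x) |v(x)|²`,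

`V(U,x) = Σ_{plaquettes based within torus distance 3 of x, both orientations} √(3 - Re tr U_p)`.

Proof (files `HeatSlicedQuarksWilsonLichnerowicz{Defs,Inner,Links,Dirac,Shapes}.lean`):
`D_W v = m v + Σ_μ E_μ v`, `E_μ = ½(K_μ + γ_μ a_μ)`; `‖D_W v‖² = m²‖v‖² + (m+1) K[v]
+ Σ_{μ≠ν} Re⟨E_μv,E_νv⟩` with `K[v] = Σ_μ ‖(1-T_μ)v‖²` (accretivity `Re⟨v,E_μv⟩ = ½‖(1-T_μ)v‖²`
and `‖E_μv‖² = ‖(1-T_μ)v‖²`); each cross term is `¼‖(1-T_μ)(1-T_ν)v‖² ≥ 0` plus link-commutator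
terms, every commutator being a transport by `A - B` with `Σ|A-B|² = 6 - 2 Re tr U_p` for a plaquette
`p` based within distance `1`, so `Re⟨E_μv,E_νv⟩ ≥ -(15/2)√2 Φ`, `Φ = Σ_x V(U,x)|v(x)|²`; summing
the twelve ordered pairs and using `m ≥ -1/2` gives `½K[v] ≤ ‖D_W v‖² + 90√2 Φ`.
Mathlib + the tree's definitions only; no named facts (unconditional).
-/

noncomputable section

namespace Summit.QuantumFields.QCD.Theorems.WilsonLichnerowicz

open Literature.Probability.LatticeModels Matrix
open scoped ComplexConjugate

variable {L : ℕ}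

/-! ## Assembly -/

section Main

open Literature.MathematicalPhysics.QuantumLattice Literature.MathematicalPhysics.QuantumFieldTheory


variable [NeZero L]

/-- **Cross-term bound per ordered pair of directions**: `Re⟨E_μ v, E_ν v⟩ ≥ -(15/2)√2 Φ(U,v)`
for `μ ≠ ν`. -/
theorem re_ip_hop_hop_ge (U : GaugeConfig 4 L SU3) {μ ν : Fin 4} (hμν : μ ≠ ν) (v : Fld L) :
    -(15 / 2 * Real.sqrt 2 * phi U v) ≤ (ip (hop U μ v) (hop U ν v)).re := by
  rw [hop_apply, hop_apply, ip_smul_left, ip_smul_right, ip_add_left, ip_add_right, ip_add_right]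
  have hc : conj (1 / 2 : ℂ) = 1 / 2 := by
    rw [show (1 / 2 : ℂ) = ((1 / 2 : ℝ) : ℂ) by push_cast; ring, Complex.conj_ofReal]
  rw [hc, ← mul_assoc, show (1 / 2 : ℂ) * (1 / 2) = ((1 / 4 : ℝ) : ℂ) by push_cast; norm_num,
    Complex.re_ofReal_mul, Complex.add_re, Complex.add_re, Complex.add_re]
  have h1 := re_ip_lapK_lapK_ge U μ ν v
  have h2 := re_ip_lapK_spin_asym_ge U μ ν v
  have h3 := re_ip_lapK_spin_asym_ge U ν μ v
  rw [re_ip_comm] at h3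
  have h4 := re_ip_spin_asym_spin_asym_ge U hμν v
  linarith

/-- **The Lichnerowicz form bound in transport language**: for `m ≥ -1/2`,
`½ Σ_μ ‖v - T_μ v‖² ≤ ‖m v + Σ_μ E_μ v‖² + 90√2 · Φ(U,v)`. -/
theorem lichnerowicz_core (U : GaugeConfig 4 L SU3) (m : ℝ) (hm : -(1 / 2 : ℝ) ≤ m) (v : Fld L) :
    1 / 2 * ∑ μ, nsq (v - fwd U μ v) ≤
      nsq ((m : ℂ) • v + ∑ μ, hop U μ v) + 90 * Real.sqrt 2 * phi U v := by
  set K : ℝ := ∑ μ, nsq (v - fwd U μ v) with hK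
  have hK0 : 0 ≤ K := Finset.sum_nonneg fun μ _ => nsq_nonneg _
  have hΦ := phi_nonneg U v
  -- the linear term
  have hlin : (ip ((m : ℂ) • v) (∑ μ, hop U μ v)).re = m * (1 / 2 * K) := by
    rw [ip_smul_left, Complex.conj_ofReal, Complex.re_ofReal_mul, ip_sum_right, Complex.re_sum]
    simp only [re_ip_hop]
    rw [← Finset.mul_sum]
  -- the quadratic term
  have hquad : K - 90 * Real.sqrt 2 * phi U v ≤ nsq (∑ μ, hop U μ v) := by
    rw [← re_ip_self, ip_sum_left, Complex.re_sum]
    simp only [ip_sum_right, Complex.re_sum]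
    have hrow : ∀ μ : Fin 4, nsq (v - fwd U μ v) - 45 / 2 * Real.sqrt 2 * phi U v ≤
        ∑ ν, (ip (hop U μ v) (hop U ν v)).re := by
      intro μ
      rw [← Finset.add_sum_erase Finset.univ (fun ν => (ip (hop U μ v) (hop U ν v)).re)
        (Finset.mem_univ μ), re_ip_self, nsq_hop]
      have hoff : ∑ ν ∈ Finset.univ.erase μ, (-(15 / 2 * Real.sqrt 2 * phi U v)) ≤
          ∑ ν ∈ Finset.univ.erase μ, (ip (hop U μ v) (hop U ν v)).re :=
        Finset.sum_le_sum fun ν hν => re_ip_hop_hop_ge U (Finset.ne_of_mem_erase hν).symm v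
      rw [Finset.sum_const, Finset.card_erase_of_mem (Finset.mem_univ μ), Finset.card_univ,
        Fintype.card_fin, show (4 - 1 : ℕ) = 3 from rfl, nsmul_eq_mul, Nat.cast_ofNat] at hoff
      linarith
    have hsum := Finset.sum_le_sum fun μ (_ : μ ∈ Finset.univ) => hrow μ
    rw [Finset.sum_sub_distrib, Finset.sum_const, Finset.card_univ, Fintype.card_fin,
      nsmul_eq_mul] at hsum
    norm_num at hsum
    rw [hK]
    linarith
  rw [nsq_add, hlin]
  have hm2 := nsq_nonneg ((m : ℂ) • v)
  nlinarith

end Main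

end Summit.QuantumFields.QCD.Theorems.WilsonLichnerowicz

namespace Summit.QuantumFields.QCD.Theorems

open Literature.Probability.LatticeModels Matrix WilsonLichnerowicz
open scoped ComplexConjugate

/-- **Item stmt-QuantumFields-8874 (`WilsonLichnerowicz`, support of route HeatSlicedQuarks).**
Lattice Lichnerowicz form bound for Wilson fermions (`r = 1`) in an arbitrary `SU(3)` lattice gauge
field on the four-torus: with the absolute constant `C = 90√2`, for every `L`, `U`, every bare
mass `m ∈ [-1/2, 1]` and every quark field `v`,
`½ Σ_{x,μ} |U(x,μ)v(x+μ̂) - v(x)|² ≤ ‖D_W v‖² + C Σ_x V(U,x)|v(x)|²`,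
`V(U,x) = Σ_{plaquettes based within torus distance 3 of x} √(3 - Re tr U_p)`.
Proof: `D_W = m + Σ_μ E_μ`, `E_μ = ½(K_μ + γ_μ a_μ)` with `K_μ = 2 - T_μ - T_μ†`,
`a_μ = T_μ - T_μ†`; per direction `Re⟨v,E_μv⟩ = ½‖(1-T_μ)v‖²`, `‖E_μv‖² = ‖(1-T_μ)v‖²`; the
cross terms `Re⟨E_μv,E_νv⟩` are a manifestly nonnegative part `¼‖(1-T_μ)(1-T_ν)v‖²` plus
link-commutator terms, each commutator being a transport by `A - B` with
`Σ|A-B|² = 6 - 2 Re tr U_p` for a plaquette `p` at a neighbouring site. -/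
theorem wilsonLichnerowicz_proof :
    Summit.QuantumFields.QCD.Theses.HeatSlicedQuarks.WilsonLichnerowicz := by
  refine ⟨90 * Real.sqrt 2, ?_⟩
  intro L _ U m hm v
  have core := lichnerowicz_core U m hm.1 v
  calc _ = 1 / 2 * ∑ μ, nsq (v - fwd U μ v) := by
        congr 1
        rw [Finset.sum_comm]
        refine Finset.sum_congr rfl fun μ _ => ?_
        rw [nsq, Fintype.sum_prod_type]
        refine Finset.sum_congr rfl fun x _ => ?_
        rw [Fintype.sum_prod_type]
        refine Finset.sum_congr rfl fun a _ => Finset.sum_congr rfl fun α _ => ?_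
        rw [Pi.sub_apply, norm_sub_rev]
        rfl
    _ ≤ nsq ((m : ℂ) • v + ∑ μ, hop U μ v) + 90 * Real.sqrt 2 * phi U v := core
    _ = _ := by
        rw [← wilsonDirac_mulVec]
        rfl


end Summit.QuantumFields.QCD.Theorems
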